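import Mathlib
import Summits.Ventures.PercRepro.TriangleCapThreeRowOneCapEight
import Summits.Ventures.PercRepro.TriangleCapThreeRowOneLocus
import Summits.Ventures.PercRepro.TriangleCapDiamondExtremal

/-!
# PercRepro — THE SECOND-ORDER LOCUS OF THE ROW `a = 3` AT `r = 1` FOR EVERY `k ≥ 8`: the cells `(8, 14)` and
`(9, 17)` through the envelope (p3, gen 45; part 200d)

Part 200b proved the locus for `k ≥ 10`, part 200c the cap for every `k ≥ 8`. Here: `three_one_del_two_eight` — at
`k = 8` a vertex of degree `2` is deleted onto `(7, 12)`, where every `K₄⁻`-free graph is `K_{3,4}`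
(`k4mFree_extremal_bipSub`), so `D` is `3`-bipartite, a hung `K_{3,4}`, or `2` below; `three_one_cross_small` — a
vertex of degree `≤ 1` at `k = 8, 9`: `D − z` exceeds the envelope `4m ≤ k²` except `K_{4,4}` plus a pendant edge at
`(9, 17)`, which is `4` below. Hence `three_row_one_second_locus'` (`8 ≤ k`) and
`three_row_one_second_best_maximisers'`: for EVERY `k ≥ 8` the second-best graphs of the cell `(k, 3, 1)` are exactly
the hung `K_{3,k−4}` — the census's `3,360 / 7,560 / 15,120` labelled graphs at `k = 8, 9, 10`. Axioms: standard.
-/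

namespace PercRepro

namespace TriangleCap

namespace C047

open Finset

variable {V : Type*} [Fintype V] [DecidableEq V]

/-- The arithmetic of the degree-`2` deletion onto a `4`-bipartite `D − z` at `k = 8`: impossible (`12` edges on
`7` vertices force `K_{3,4}`) — handled by the envelope; the `3`-bipartite case is part 200b's. -/
theorem three_one_del_two_eight (D : SimpleGraph V) [DecidableRel D.Adj] (hK : K4mFree D)
    (hk : Fintype.card V = 8) (hm : D.edgeFinset.card + 1 = 3 * (Fintype.card V - 3)) (z : V)
    (hz : deg D z = 2) :
    (∃ A : Finset V, A.card = 3 ∧ BipSub D A) ∨ HungK3 D ∨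
      ∑ v, deg D v * deg D v + (Fintype.card V - 2) + 2 * (Fintype.card V - 7) + 2 ≤
        D.edgeFinset.card * Fintype.card V := by
  have hK' := k4mFree_del D hK z
  have hcard' := card_del z
  have hedges' := card_edges_del D z
  have hsq := sum_deg_sq_del D z
  rw [hz] at hedges' hsq
  have hcardW' : Fintype.card {v : V // v ≠ z} = 7 := by omega
  rw [hk] at hm
  have hE' : (del D z).edgeFinset.card = 3 * (Fintype.card {v : V // v ≠ z} - 3) := by
    rw [hcardW']
    omega
  obtain ⟨A', hA'card, hA'⟩ := k4mFree_extremal_bipSub (del D z) hK' (by omega) (by rw [hcardW']; omega)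
  rw [hcardW'] at hA'card
  norm_num at hA'card
  by_cases hin : ∀ w : {v : V // v ≠ z}, D.Adj w.1 z → w ∈ A'
  · obtain ⟨B, hBcard, hB⟩ := bipSub_lift D z A' hA' hin
    exact Or.inl ⟨B, by rw [hBcard, hA'card], hB⟩
  push Not at hin
  obtain ⟨w₀, hw₀, hw₀A⟩ := hin
  by_cases hin2 : ∃ w : {v : V // v ≠ z}, D.Adj w.1 z ∧ w ∈ A'
  · obtain ⟨w, hw, hwA⟩ := hin2
    exact Or.inr (Or.inl ⟨z, A', hz, hA'card, hA', hE', w, w₀, hwA, hw₀A, hw, hw₀⟩)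
  · right; right
    push Not at hin2
    obtain ⟨T, hTdef⟩ : ∃ T, ∑ w : {v : V // v ≠ z}, (if D.Adj w.1 z then deg (del D z) w else 0) = T := ⟨_, rfl⟩
    obtain ⟨S', hS'def⟩ : ∃ S', ∑ w : {v : V // v ≠ z}, deg (del D z) w * deg (del D z) w = S' := ⟨_, rfl⟩
    rw [hTdef, hS'def] at hsq
    have hT : T ≤ 6 := by
      rw [← hTdef]
      have h1 : ∑ w : {v : V // v ≠ z}, (if D.Adj w.1 z then deg (del D z) w else 0) ≤
          ∑ w : {v : V // v ≠ z}, (if D.Adj w.1 z then 3 else 0) := by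
        apply sum_le_sum
        intro w _
        by_cases h : D.Adj w.1 z
        · simp only [h, if_true]
          have := deg_le_card_of_bipSub (del D z) A' hA' w (hin2 w h)
          rw [hA'card] at this
          exact this
        · simp only [h, if_false]
          exact le_refl 0
      rw [sum_del_nbhd_const D z 3, hz] at h1
      exact h1
    haveI : Nonempty {v : V // v ≠ z} := Fintype.card_pos_iff.mp (by omega)
    have hS' := sum_deg_sq_eq_of_bipSub_full (del D z) A' 3 hA'card hA' hE' inferInstance
    rw [hS'def, hE', hcardW'] at hS'
    rw [hsq, hk]
    omega

/-- **A VERTEX OF DEGREE `≤ 1` ON THE CELLS `(8, 14)` AND `(9, 17)` IS STRICTLY BELOW:** `D − z` has more edges than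
the envelope allows, except `K_{4,4}` plus a pendant edge at `(9, 17)` (`Σ d² = 138 < 140`). -/
theorem three_one_cross_small (D : SimpleGraph V) [DecidableRel D.Adj] (hK : K4mFree D)
    (hk8 : 8 ≤ Fintype.card V) (hk9 : Fintype.card V ≤ 9)
    (hm : D.edgeFinset.card + 1 = 3 * (Fintype.card V - 3)) (z : V) (hz : deg D z ≤ 1) :
    ∑ v, deg D v * deg D v + (Fintype.card V - 2) + 2 * (Fintype.card V - 7) + 2 ≤
      D.edgeFinset.card * Fintype.card V := by
  have hK' := k4mFree_del D hK z
  have hcard' := card_del z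
  have hedges' := card_edges_del D z
  have hsq := sum_deg_sq_del D z
  have henv := four_mul_card_edges_le_sq (del D z) hK' (by omega)
  obtain ⟨d, hd⟩ : ∃ d, deg D z = d := ⟨_, rfl⟩
  rw [hd] at hz hedges' hsq
  rcases Nat.lt_or_ge (Fintype.card V) 9 with hk | hk
  · -- `k = 8`: `13 − d ≥ 13 > 12` edges on `7` vertices
    exfalso
    have hc : Fintype.card {v : V // v ≠ z} = 7 := by omega
    rw [hc] at henv
    omega
  · -- `k = 9`
    have hk' : Fintype.card V = 9 := by omega
    have hc : Fintype.card {v : V // v ≠ z} = 8 := by omega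
    rw [hc] at henv
    rw [hk'] at hm
    rcases Nat.eq_zero_or_pos d with hd0 | hd1
    · exfalso
      omega
    · have hd1' : d = 1 := by omega
      subst hd1'
      -- `D − z = K_{4,4}`
      have hE' : (del D z).edgeFinset.card = 16 := by omega
      obtain ⟨A', hA'card, hA'⟩ := k4mFree_extremal_bipSub (del D z) hK' (by omega) (by rw [hc]; omega)
      rw [hc] at hA'card
      norm_num at hA'card
      haveI : Nonempty {v : V // v ≠ z} := Fintype.card_pos_iff.mp (by omega)
      have hS' := sum_deg_sq_eq_of_bipSub_full (del D z) A' 4 hA'card hA' (by rw [hE', hc]) inferInstance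
      rw [hE', hc] at hS'
      have hT : ∑ w : {v : V // v ≠ z}, (if D.Adj w.1 z then deg (del D z) w else 0) ≤ 4 := by
        have h1 : ∑ w : {v : V // v ≠ z}, (if D.Adj w.1 z then deg (del D z) w else 0) ≤
            ∑ w : {v : V // v ≠ z}, (if D.Adj w.1 z then 4 else 0) := by
          apply sum_le_sum
          intro w _
          by_cases h : D.Adj w.1 z
          · simp only [h, if_true]
            by_cases hwA : w ∈ A'
            · have := deg_le_of_bipSub_mem (del D z) A' hA' w hwA
              rw [hA'card, hc] at this
              exact this
            · have := deg_le_card_of_bipSub (del D z) A' hA' w hwA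
              rw [hA'card] at this
              exact this
          · simp only [h, if_false]
            exact le_refl 0
        rw [sum_del_nbhd_const D z 4, hd] at h1
        exact h1
      rw [hsq, hS', hk']
      omega

/-- **THE SECOND-ORDER LOCUS OF THE ROW `a = 3` AT `r = 1`, EVERY `k ≥ 8`:** a `K₄⁻`-free graph with `3 (k − 3) − 1`
edges that is not `3`-bipartite and attains `Σ_v d(v)² + (k − 2) + 2 (k − 7) = m k` is a hung `K_{3,k−4}`. -/
theorem three_row_one_second_locus' (D : SimpleGraph V) [DecidableRel D.Adj] (hK : K4mFree D)
    (hk : 8 ≤ Fintype.card V) (hm : D.edgeFinset.card + 1 = 3 * (Fintype.card V - 3))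
    (hnb : ¬ ∃ A : Finset V, A.card = 3 ∧ BipSub D A)
    (heq : ∑ v, deg D v * deg D v + (Fintype.card V - 2) + 2 * (Fintype.card V - 7) =
      D.edgeFinset.card * Fintype.card V) :
    HungK3 D := by
  rcases Nat.lt_or_ge (Fintype.card V) 10 with hk10 | hk10
  · have hcap : ∀ v, deg D v + 3 ≤ Fintype.card V := fun v =>
      deg_add_le_card_of_dense D hK 3 (le_refl 3) (by omega)
        (cap_arith 3 (Fintype.card V) D.edgeFinset.card 1 (by omega) (by omega) (by omega)) v
    by_cases hsmall : ∃ z, deg D z ≤ 2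
    · obtain ⟨z, hz⟩ := hsmall
      rcases Nat.lt_or_ge (deg D z) 2 with hz1 | hz2
      · exfalso
        have := three_one_cross_small D hK hk (by omega) hm z (by omega)
        omega
      · rcases Nat.lt_or_ge (Fintype.card V) 9 with hk8 | hk9
        · rcases three_one_del_two_eight D hK (by omega) hm z (by omega) with h | h | h
          · exact absurd h hnb
          · exact h
          · exfalso
            omega
        · rcases three_one_del_two D hK hk9 hm hcap z (by omega) with h | h | h
          · exact absurd h hnb
          · exact h
          · exfalso
            omega
    · push Not at hsmall
      exfalso
      by_cases hx : ∃ x, deg D x + 3 = Fintype.card V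
      · obtain ⟨x, hx⟩ := hx
        rcases three_one_cap_strict' D hK hk hm (fun v => by have := hsmall v; omega) x hx with h | h
        · exact hnb h
        · omega
      · push Not at hx
        have hcap' : ∀ v, deg D v + 4 ≤ Fintype.card V := fun v => by
          have h1 := hcap v
          have h2 := hx v
          omega
        have := three_one_convex_strict D (by omega) hm hcap' (fun v => by have := hsmall v; omega)
        omega
  · exact three_row_one_second_locus D hK hk10 hm hnb heq

/-- **THE SECOND-BEST GRAPHS OF THE CELL `(k, 3, 1)` FOR EVERY `k ≥ 8`, ON `Fin k`:** a non-`3`-bipartite `K₄⁻`-free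
graph with `3 (k − 3) − 1` edges attains `Σ_v d(v)² + (k − 2) + 2 (k − 7) = m k` iff it is a hung `K_{3,k−4}`. -/
theorem three_row_one_second_best_maximisers' (k : ℕ) (hk : 8 ≤ k) (D : SimpleGraph (Fin k)) [DecidableRel D.Adj]
    (hK : K4mFree D) (hm : D.edgeFinset.card + 1 = 3 * (k - 3))
    (hnb : ¬ ∃ A : Finset (Fin k), A.card = 3 ∧ BipSub D A) :
    ∑ v, deg D v * deg D v + (k - 2) + 2 * (k - 7) = D.edgeFinset.card * k ↔ HungK3 D := by
  have hcard : Fintype.card (Fin k) = k := Fintype.card_fin k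
  constructor
  · intro heq
    exact three_row_one_second_locus' D hK (by rw [hcard]; exact hk) (by rw [hcard]; exact hm) hnb
      (by rw [hcard]; exact heq)
  · intro hH
    have := (hungK3_value D (by rw [hcard]; omega) hH).2.1
    rw [hcard] at this
    exact this

end C047

end TriangleCap

end PercRepro
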